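import Summits.CriticalPhenomena.PercolationContinuityZ3.Theorems.SahiGridPatternOrderNTensor
import Summits.CriticalPhenomena.PercolationContinuityZ3.Theorems.SahiGridPatternOrderNFour

/-!
# The order-4 pattern tensor in closed form (the coefficient array of `Z⁴E₄` in the Latin monomials)

Support file (Sahi cell `prim-sahi`, seat `prim-sahi-typer`, generation 26; `--supports stmt-CriticalPhenomena-4575`).  Bookkeeping
definitions (`mono`, `monoAx`, `cnt`, `tc4`), pure proofs, no `sorry`, standard axioms; the sixteen counting facts over `S_4` are `decide`d.

`patTensor 4 d x = sStarN 4 d ({x_0},…,{x_3})` (…OrderNTensor) is a sum over the `24^d` patterns of the order-4 kernel, whose fifteen monomials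
(`copyKernel_four`) each use every slot once: monomial `κ : slot ↦ copy`.  On singleton incidence matrices a monomial FACTORISES OVER THE AXES,
so the pattern sum is a product of per-axis permutation counts (`Fintype.prod_sum`):
  **`patTensor_four_eq : patTensor 4 d x = tc4 d x`**,  `tc4 d x := Σ_{15 terms} c_κ · ∏_{a<d} cnt κ (i ↦ x_i(a))`,
  `cnt κ v := #{σ ∈ S_4 : σ(κ i) = v_i ∀ i}` = `(4 − #blocks)! · [v constant on the blocks of κ and injective across blocks]`
(the sixteen closed forms `cnt_3333`, …, `cnt_0123`, by `decide`).  This is the formula the cell's census engines implement (verified entrywise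
against them: d = 1, 2 all entries, d = 3 300 000 entries — memo FROM-prim-sahi-typer-gen26 §5b) and the form in which the 1 324 exact bilinear
slice certificates for `PatternPosN 4 2` found by this seat can be replayed by `decide`. [this work]
-/

namespace Summit.CriticalPhenomena.PercolationContinuityZ3.Theorems.SahiGridPatternN

open Finset
open SahiCopyKernel (copyKernel incMatrix)
open scoped BigOperators

variable {d : ℕ}

/-! ### Monomials of the order-4 kernel -/

/-- The monomial of a copy assignment `κ : slot ↦ copy`: `∏_i M i (κ i)`. [this work] -/
def mono {R : Type*} [CommRing R] (κ : Fin 4 → Fin 4) (M : Fin 4 → Fin 4 → R) : R := ∏ i : Fin 4, M i (κ i)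

/-- `copyKernel_four` regrouped by copy assignments (each of the 15 set partitions of the slots, block at its largest slot). [this work] -/
theorem copyKernel_four_mono {R : Type*} [CommRing R] (M : Fin 4 → Fin 4 → R) :
    copyKernel 4 M =
      6 * mono ![3, 3, 3, 3] M
      - 2 * (mono ![0, 3, 3, 3] M + mono ![3, 1, 3, 3] M + mono ![3, 3, 2, 3] M + mono ![2, 2, 2, 3] M)
      - (mono ![1, 1, 3, 3] M + mono ![2, 3, 2, 3] M + mono ![3, 2, 2, 3] M)
      + (mono ![1, 1, 2, 3] M + mono ![2, 1, 2, 3] M + mono ![3, 1, 2, 3] M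
          + mono ![0, 2, 2, 3] M + mono ![0, 3, 2, 3] M + mono ![0, 1, 3, 3] M)
      - mono ![0, 1, 2, 3] M := by
  rw [copyKernel_four]
  simp only [mono, Fin.prod_univ_four, Matrix.cons_val_zero, Matrix.cons_val_one, Matrix.cons_val]
  ring

/-- The per-axis factor of a monomial at a permutation `σ` of one axis: `∏_i [σ (κ i) = v i]`. [this work] -/
def monoAx (κ : Fin 4 → Fin 4) (σ : Equiv.Perm (Fin 4)) (v : Fin 4 → Fin 4) : ℤ := ∏ i : Fin 4, if σ (κ i) = v i then 1 else 0

/-- The per-axis permutation count `cnt κ v = Σ_{σ ∈ S_4} ∏_i [σ (κ i) = v i] = #{σ : σ(κ i) = v i ∀ i}`. [this work] -/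
def cnt (κ : Fin 4 → Fin 4) (v : Fin 4 → Fin 4) : ℤ := ∑ σ : Equiv.Perm (Fin 4), monoAx κ σ v

/-- Indicator of equality of points of `[4]^d` = product of the coordinate indicators. [this work] -/
theorem ite_eq_pt_eq_prod (p q : Pn 4 d) : (if p = q then (1 : ℤ) else 0) = ∏ a : Fin d, if p a = q a then 1 else 0 := by
  by_cases h : p = q
  · subst h; simp
  · rw [if_neg h]
    obtain ⟨a, ha⟩ : ∃ a, p a ≠ q a := by
      by_contra hc; push Not at hc; exact h (funext hc)
    exact (Finset.prod_eq_zero (mem_univ a) (if_neg ha)).symm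

/-- On the singleton incidence matrix at a pattern, a monomial factorises over the axes. [this work] -/
theorem mono_singletons (κ : Fin 4 → Fin 4) (x : Fin 4 → Pn 4 d) (π : Fin d → Equiv.Perm (Fin 4)) :
    mono κ (fun i c => if col π c = x i then (1 : ℤ) else 0) = ∏ a : Fin d, monoAx κ (π a) (fun i => x i a) := by
  unfold mono monoAx
  simp_rw [ite_eq_pt_eq_prod]
  rw [Finset.prod_comm]
  rfl

/-- The pattern sum of a monomial is the product over the axes of the permutation counts. [this work] -/
theorem sum_mono_singletons (κ : Fin 4 → Fin 4) (x : Fin 4 → Pn 4 d) :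
    ∑ π : Fin d → Equiv.Perm (Fin 4), mono κ (fun i c => if col π c = x i then (1 : ℤ) else 0) =
      ∏ a : Fin d, cnt κ (fun i => x i a) := by
  simp_rw [mono_singletons]
  unfold cnt
  exact (Fintype.prod_sum (fun a σ => monoAx κ σ (fun i => x i a))).symm

/-! ### The closed form -/

/-- **The order-4 pattern tensor in product form**: fifteen terms, each a product over the axes of a permutation count. [this work] -/
def tc4 (d : ℕ) (x : Fin 4 → Pn 4 d) : ℤ :=
  6 * ∏ a : Fin d, cnt ![3, 3, 3, 3] (fun i => x i a)
  - 2 * ((∏ a : Fin d, cnt ![0, 3, 3, 3] (fun i => x i a)) + (∏ a : Fin d, cnt ![3, 1, 3, 3] (fun i => x i a))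
        + (∏ a : Fin d, cnt ![3, 3, 2, 3] (fun i => x i a)) + (∏ a : Fin d, cnt ![2, 2, 2, 3] (fun i => x i a)))
  - ((∏ a : Fin d, cnt ![1, 1, 3, 3] (fun i => x i a)) + (∏ a : Fin d, cnt ![2, 3, 2, 3] (fun i => x i a))
        + (∏ a : Fin d, cnt ![3, 2, 2, 3] (fun i => x i a)))
  + ((∏ a : Fin d, cnt ![1, 1, 2, 3] (fun i => x i a)) + (∏ a : Fin d, cnt ![2, 1, 2, 3] (fun i => x i a))
        + (∏ a : Fin d, cnt ![3, 1, 2, 3] (fun i => x i a)) + (∏ a : Fin d, cnt ![0, 2, 2, 3] (fun i => x i a))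
        + (∏ a : Fin d, cnt ![0, 3, 2, 3] (fun i => x i a)) + (∏ a : Fin d, cnt ![0, 1, 3, 3] (fun i => x i a)))
  - ∏ a : Fin d, cnt ![0, 1, 2, 3] (fun i => x i a)

/-- **`patTensor 4 d = tc4 d`.** [this work] -/
theorem patTensor_four_eq (x : Fin 4 → Pn 4 d) : patTensor 4 d x = tc4 d x := by
  unfold patTensor sStarN tc4
  simp_rw [incMatrix_singletons, copyKernel_four_mono]
  simp only [Finset.sum_add_distrib, Finset.sum_sub_distrib, ← Finset.mul_sum, sum_mono_singletons]

/-! ### The sixteen counting facts over `S_4` (closed forms of `cnt`) -/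

/-- `cnt (3,3,3,3) v` = all four slots at copy 3: `6·[v₀=v₁=v₂=v₃]` — a count of permutations of `Fin 4`, by `decide`. [this work] -/
theorem cnt_3333 (v : Fin 4 → Fin 4) :
    cnt ![3, 3, 3, 3] v = if v 0 = v 1 ∧ v 1 = v 2 ∧ v 2 = v 3 then 6 else 0 := by
  revert v; decide +kernel

/-- `cnt (0,3,3,3) v` = `2·[v₁=v₂=v₃ ≠ v₀]` — a count of permutations of `Fin 4`, by `decide`. [this work] -/
theorem cnt_0333 (v : Fin 4 → Fin 4) :
    cnt ![0, 3, 3, 3] v = if v 1 = v 2 ∧ v 2 = v 3 ∧ v 0 ≠ v 1 then 2 else 0 := by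
  revert v; decide +kernel

/-- `cnt (3,1,3,3) v` = `2·[v₀=v₂=v₃ ≠ v₁]` — a count of permutations of `Fin 4`, by `decide`. [this work] -/
theorem cnt_3133 (v : Fin 4 → Fin 4) :
    cnt ![3, 1, 3, 3] v = if v 0 = v 2 ∧ v 2 = v 3 ∧ v 1 ≠ v 0 then 2 else 0 := by
  revert v; decide +kernel

/-- `cnt (3,3,2,3) v` = `2·[v₀=v₁=v₃ ≠ v₂]` — a count of permutations of `Fin 4`, by `decide`. [this work] -/
theorem cnt_3323 (v : Fin 4 → Fin 4) :
    cnt ![3, 3, 2, 3] v = if v 0 = v 1 ∧ v 1 = v 3 ∧ v 2 ≠ v 0 then 2 else 0 := by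
  revert v; decide +kernel

/-- `cnt (2,2,2,3) v` = `2·[v₀=v₁=v₂ ≠ v₃]` — a count of permutations of `Fin 4`, by `decide`. [this work] -/
theorem cnt_2223 (v : Fin 4 → Fin 4) :
    cnt ![2, 2, 2, 3] v = if v 0 = v 1 ∧ v 1 = v 2 ∧ v 3 ≠ v 0 then 2 else 0 := by
  revert v; decide +kernel

/-- `cnt (1,1,3,3) v` = `2·[v₀=v₁ ≠ v₂=v₃]` — a count of permutations of `Fin 4`, by `decide`. [this work] -/
theorem cnt_1133 (v : Fin 4 → Fin 4) :
    cnt ![1, 1, 3, 3] v = if v 0 = v 1 ∧ v 2 = v 3 ∧ v 0 ≠ v 2 then 2 else 0 := by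
  revert v; decide +kernel

/-- `cnt (2,3,2,3) v` = `2·[v₀=v₂ ≠ v₁=v₃]` — a count of permutations of `Fin 4`, by `decide`. [this work] -/
theorem cnt_2323 (v : Fin 4 → Fin 4) :
    cnt ![2, 3, 2, 3] v = if v 0 = v 2 ∧ v 1 = v 3 ∧ v 0 ≠ v 1 then 2 else 0 := by
  revert v; decide +kernel

/-- `cnt (3,2,2,3) v` = `2·[v₀=v₃ ≠ v₁=v₂]` — a count of permutations of `Fin 4`, by `decide`. [this work] -/
theorem cnt_3223 (v : Fin 4 → Fin 4) :
    cnt ![3, 2, 2, 3] v = if v 0 = v 3 ∧ v 1 = v 2 ∧ v 0 ≠ v 1 then 2 else 0 := by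
  revert v; decide +kernel

/-- `cnt (1,1,2,3) v` = `[v₀=v₁; v₀,v₂,v₃ distinct]` — a count of permutations of `Fin 4`, by `decide`. [this work] -/
theorem cnt_1123 (v : Fin 4 → Fin 4) :
    cnt ![1, 1, 2, 3] v = if v 0 = v 1 ∧ v 0 ≠ v 2 ∧ v 0 ≠ v 3 ∧ v 2 ≠ v 3 then 1 else 0 := by
  revert v; decide +kernel

/-- `cnt (2,1,2,3) v` = `[v₀=v₂; v₀,v₁,v₃ distinct]` — a count of permutations of `Fin 4`, by `decide`. [this work] -/
theorem cnt_2123 (v : Fin 4 → Fin 4) :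
    cnt ![2, 1, 2, 3] v = if v 0 = v 2 ∧ v 0 ≠ v 1 ∧ v 0 ≠ v 3 ∧ v 1 ≠ v 3 then 1 else 0 := by
  revert v; decide +kernel

/-- `cnt (3,1,2,3) v` = `[v₀=v₃; v₀,v₁,v₂ distinct]` — a count of permutations of `Fin 4`, by `decide`. [this work] -/
theorem cnt_3123 (v : Fin 4 → Fin 4) :
    cnt ![3, 1, 2, 3] v = if v 0 = v 3 ∧ v 0 ≠ v 1 ∧ v 0 ≠ v 2 ∧ v 1 ≠ v 2 then 1 else 0 := by
  revert v; decide +kernel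

/-- `cnt (0,2,2,3) v` = `[v₁=v₂; v₀,v₁,v₃ distinct]` — a count of permutations of `Fin 4`, by `decide`. [this work] -/
theorem cnt_0223 (v : Fin 4 → Fin 4) :
    cnt ![0, 2, 2, 3] v = if v 1 = v 2 ∧ v 1 ≠ v 0 ∧ v 1 ≠ v 3 ∧ v 0 ≠ v 3 then 1 else 0 := by
  revert v; decide +kernel

/-- `cnt (0,3,2,3) v` = `[v₁=v₃; v₀,v₁,v₂ distinct]` — a count of permutations of `Fin 4`, by `decide`. [this work] -/
theorem cnt_0323 (v : Fin 4 → Fin 4) :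
    cnt ![0, 3, 2, 3] v = if v 1 = v 3 ∧ v 1 ≠ v 0 ∧ v 1 ≠ v 2 ∧ v 0 ≠ v 2 then 1 else 0 := by
  revert v; decide +kernel

/-- `cnt (0,1,3,3) v` = `[v₂=v₃; v₀,v₁,v₂ distinct]` — a count of permutations of `Fin 4`, by `decide`. [this work] -/
theorem cnt_0133 (v : Fin 4 → Fin 4) :
    cnt ![0, 1, 3, 3] v = if v 2 = v 3 ∧ v 2 ≠ v 0 ∧ v 2 ≠ v 1 ∧ v 0 ≠ v 1 then 1 else 0 := by
  revert v; decide +kernel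

/-- `cnt (0,1,2,3) v` = `[v₀,v₁,v₂,v₃ pairwise distinct]` — a count of permutations of `Fin 4`, by `decide`. [this work] -/
theorem cnt_0123 (v : Fin 4 → Fin 4) :
    cnt ![0, 1, 2, 3] v = if v 0 ≠ v 1 ∧ v 0 ≠ v 2 ∧ v 0 ≠ v 3 ∧ v 1 ≠ v 2 ∧ v 1 ≠ v 3 ∧ v 2 ≠ v 3 then 1 else 0 := by
  revert v; decide +kernel

end Summit.CriticalPhenomena.PercolationContinuityZ3.Theorems.SahiGridPatternN
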